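import Summits.BirchSwinnertonDyer.BirchSwinnertonDyer.Theorems.SemiOrdinaryEisensteinDescentShaTwoCochainBridgeIdele
import HarnessLib

/-!
# The Ш²-cochain bridge, local half: at a place with idèle projection `π`, the primitive `φ = π ξ̃ − dη̃` of `π F` and the
# ON-THE-NOSE identity `φ ∪ γ − π H = π Z − d(η̃ ∘ γ̃)` (pointwise cochain identities; step S2b of SHA2-BRIDGE-w3g7)

Route `SemiOrdinaryEisensteinDescent` (BSD, rung W-ALL row 2·3@3), Kolyvagin column, Cassels–Tate lane: print item
`CasselsTateLevelInputsFact` (stmt-BirchSwinnertonDyer-20191), last input `hPTc` (Milne I Thm. 4.10 (a) for `Ш²(K, E[q])` in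
`PTChoice` cochain form).  Sequel of `…ShaTwoCochainBridgeIdele` (S2a: the idèle `2`-cocycle `Z = B − uJ ∘ H`,
`B(σ,τ) = uJ (ξ̃(σ)(σ γ̃(τ))) + h̃(c(σ,τ))`, with idèle-class image `h ∘ c`).  This file is step S2b of the memo
`Cruxes/WildKolyvaginUpperAtThree/SHA2-BRIDGE-w3g7.md` §1 (v): the LOCAL data of the bridge's admissible choice and its local
`2`-cocycle, again for ARBITRARY discrete Galois modules and pointwise, over an arbitrary extension field `E/K` (a completion
`K_v`) with the tree's restriction `θ = absGaloisRestrict K E : Γ_E → Γ_K`, a `θ`-equivariant "idèle projection" `π : J → U'`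
(`U'` a discrete `Γ_E`-module: `K̄_vˣ`; cell bsd-schneider's `IdeleProjection.toIntertwining`) and the induced `π ∘ uJ : U → U'`
(`ι_v : K̄ˣ → K̄_vˣ`).  Width seat `bsd-wall-soed-p2-w3` g7; `--supports stmt-BirchSwinnertonDyer-20480`, helper.  Route-free.

THE MATHEMATICS.  With the data of S2a and, over `E`: `η := π ∘ h̃ : X → U'`, a ℤ-linear lift `η̃ : Y → U'` of `η` along `i`
(`Module.Baer`, divisibility of `K̄_vˣ`), and the `Hom(Z, U')`-valued `1`-cochain `φ` of `Γ_E` determined by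
`φ(σ') ∘ p = π ∘ uJ ∘ ξ̃(θσ') − (σ'⋆η̃ − η̃)` (the right side kills `i(X)`: `ξ̃(θσ') ∘ i = ξ(θσ')` and
`π ∘ uJ ∘ ξ(θσ') = σ'⋆η − η` — road B's (d), `IsSES.map_res_δ₀_eq_zero_of_extends`):

* **`dOne_bridgePrimitive`** — `dφ = π ∘ uJ ∘ F ∘ θ`: `(σ'⋆φ(τ') − φ(σ'τ') + φ(σ'))(p y) = π (uJ (F(θσ', θτ')(p y)))` — `φ` is a
  local PRIMITIVE of the `2`-cocycle `F` (the connecting cocycle representing `Ψ h`) read in `Hom(Z, U')`;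
* **`bridgeLocalCocycle_eq`** — the ON-THE-NOSE identity of local `2`-cochains of `Γ_E`:
  `φ(σ')(σ' γ(θτ')) − π (uJ (H(θσ', θτ'))) = π (Z(θσ', θτ')) − (σ' η̃(γ̃(θτ')) − η̃(γ̃(θ(σ'τ'))) + η̃(γ̃(θσ')))`,
  i.e. `φ ∪ γ|_E − (π ∘ uJ) H|_E = π Z|_E − d(η̃ ∘ γ̃|_E)`: the admissible choice `(H; φ)` for `(F, γ)` has, at this place, the local
  class of the idèle cocycle `Z` projected to `K̄_vˣ` — whose invariant is the idèle local invariant (cell bsd-schneider's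
  `IdeleCohomology.localInv_eq_readout`), so that `Σ_v inv_v` of the choice is the global invariant of `[Z̄] = h_*(δ₁ [γ])` (S3).

THEOREMS ONLY (pointwise identities; no definition, no named fact, no instance, no `sorry`); nothing arithmetic is proved here — no
case of BSD, Poitou–Tate or Cassels–Tate.

## References
* [MilneADT2006] J. S. Milne, *Arithmetic Duality Theorems*, 2nd ed. (2006), I §0 ((0.8)), I Thm. 4.10 (a) (proof, p. 58), Lemma 4.13.
* [NeukirchSchmidtWingberg2008] J. Neukirch, A. Schmidt, K. Wingberg, *Cohomology of Number Fields* (2008), (1.3.2), Prop. 1.4.1,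
  (1.5.2) (compatibility of `δ` and cup products with restriction).
* [Harari2020] D. Harari, *Galois Cohomology and Class Field Theory* (2020), Prop. 16.17, Thm. 16.26, Thm. 17.13.
-/

noncomputable section

-- `Summit.<P>.<Sub>` repeats `BirchSwinnertonDyer` by the tree's layout convention (D-0017)
set_option linter.dupNamespace false
set_option autoImplicit false

namespace Summit.BirchSwinnertonDyer.BirchSwinnertonDyer.Theorems.ShaTwoCochain

open Literature.NumberTheory.GaloisRepresentations Literature.NumberTheory.GaloisRepresentations.HomDual
open Literature.Algebra.Homology Literature.Algebra.Homology.DiscreteRep ContRepresentation Field Literature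
open scoped ContRepresentation

variable {K : Type} [Field K]
variable {X Y Z U J : Type}
  [AddCommGroup X] [TopologicalSpace X] [DiscreteTopology X] [Module.Finite ℤ X]
  [AddCommGroup Y] [TopologicalSpace Y] [DiscreteTopology Y] [Module.Finite ℤ Y]
  [AddCommGroup Z] [TopologicalSpace Z] [DiscreteTopology Z] [Module.Finite ℤ Z]
  [AddCommGroup U] [TopologicalSpace U] [DiscreteTopology U]
  [AddCommGroup J] [TopologicalSpace J] [DiscreteTopology J]
variable {ρX : DiscreteGaloisModule K X} {ρY : DiscreteGaloisModule K Y} {ρZ : DiscreteGaloisModule K Z}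
  {ρU : DiscreteGaloisModule K U} {ρJ : DiscreteGaloisModule K J}
variable (i : ρX.toContRepresentation →ⁱL ρY.toContRepresentation)
  (p : ρY.toContRepresentation →ⁱL ρZ.toContRepresentation)
  (uJ : ρU.toContRepresentation →ⁱL ρJ.toContRepresentation)
-- the place: an extension field `E/K` (a completion), a discrete `Γ_E`-module `U'` (`K̄_vˣ`) and a `θ`-equivariant `π : J → U'`
variable {E : Type} [Field E] [Algebra K E] {U' : Type} [AddCommGroup U'] [TopologicalSpace U'] [DiscreteTopology U']
  {ρU' : DiscreteGaloisModule E U'} (π : J →+ U')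

/-! ## §1 The `Hom`-module action over `E` on translated vectors -/

/-- `(σ'⋆Φ)(θσ' y) = σ'(Φ y)` for the `Γ_E`-module `Hom(Y|_E, U')`. [cite: MilneADT2006, I §0] -/
theorem homGaloisModule_restrictField_apply_smul (σ' : absoluteGaloisGroup E) (Φ : DiscreteRep.HomCarrier Y U') (y : Y) :
    (show Y →ₗ[ℤ] U' from homGaloisModule (GaloisRep.restrictField E ρY) ρU' σ' Φ) (ρY (absGaloisRestrict K E σ') y) =
      ρU' σ' ((show Y →ₗ[ℤ] U' from Φ) y) :=
  homGaloisModule_apply_smul (GaloisRep.restrictField E ρY) ρU' σ' Φ y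

/-! ## §2 `φ` is a local primitive of `π ∘ uJ ∘ F` -/

/-- **`dφ = π ∘ uJ ∘ F ∘ θ` pointwise on `p(Y) = Z`**: for the `Hom(Z, U')`-valued `1`-cochain `φ` of `Γ_E` with
`φ(σ') ∘ p = π ∘ uJ ∘ ξ̃(θσ') − (σ'⋆η̃ − η̃)`,
`(σ'⋆φ(τ'))(p y) − φ(σ'τ')(p y) + φ(σ')(p y) = π (uJ (F(θσ', θτ')(p y)))` for all `y : Y` — with `p` onto, `φ` is a local primitive
of the restricted connecting cocycle (the `dOne_φ` field of an admissible choice).  Hypotheses: `π` is `θ`-equivariant, `p` is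
equivariant, `F ∘ p = dξ̃` (S2a's `hF`). [cite: NeukirchSchmidtWingberg2008, (1.3.2), (1.5.2)][cite: MilneADT2006, I Thm. 4.10 (a) (proof, p. 58)] -/
theorem dOne_bridgePrimitive
    (hπ : ∀ (σ' : absoluteGaloisGroup E) (j : J), π (ρJ (absGaloisRestrict K E σ') j) = ρU' σ' (π j))
    (ξt : C(absoluteGaloisGroup K, DiscreteRep.HomCarrier Y U))
    (F : C(absoluteGaloisGroup K × absoluteGaloisGroup K, DiscreteRep.HomCarrier Z U))
    (hF : ∀ (σ τ : absoluteGaloisGroup K) (y : Y), (show Z →ₗ[ℤ] U from F (σ, τ)) (p y) =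
      (show Y →ₗ[ℤ] U from homGaloisModule ρY ρU σ (ξt τ)) y - (show Y →ₗ[ℤ] U from ξt (σ * τ)) y +
        (show Y →ₗ[ℤ] U from ξt σ) y)
    (ηt : DiscreteRep.HomCarrier Y U')
    (φ : C(absoluteGaloisGroup E, DiscreteRep.HomCarrier Z U'))
    (hφ : ∀ (σ' : absoluteGaloisGroup E) (y : Y), (show Z →ₗ[ℤ] U' from φ σ') (p y) =
      π (uJ ((show Y →ₗ[ℤ] U from ξt (absGaloisRestrict K E σ')) y)) -
        ((show Y →ₗ[ℤ] U' from homGaloisModule (GaloisRep.restrictField E ρY) ρU' σ' ηt) y - (show Y →ₗ[ℤ] U' from ηt) y))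
    (σ' τ' : absoluteGaloisGroup E) (y : Y) :
    (show Z →ₗ[ℤ] U' from homGaloisModule (GaloisRep.restrictField E ρZ) ρU' σ' (φ τ')) (p y) -
        (show Z →ₗ[ℤ] U' from φ (σ' * τ')) (p y) + (show Z →ₗ[ℤ] U' from φ σ') (p y) =
      π (uJ ((show Z →ₗ[ℤ] U from F (absGaloisRestrict K E σ', absGaloisRestrict K E τ')) (p y))) := by
  -- write `y = θσ' y₁`
  set y₁ : Y := ρY (absGaloisRestrict K E σ')⁻¹ y with hy₁
  have hy : y = ρY (absGaloisRestrict K E σ') y₁ := by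
    rw [hy₁, ← Module.End.mul_apply, ← map_mul, mul_inv_cancel, map_one, Module.End.one_apply]
  -- (1) the twisted term: `(σ'⋆φτ')(p y) = σ' (φτ' (p y₁))`
  have h1 : (show Z →ₗ[ℤ] U' from homGaloisModule (GaloisRep.restrictField E ρZ) ρU' σ' (φ τ')) (p y) =
      ρU' σ' ((show Z →ₗ[ℤ] U' from φ τ') (p y₁)) := by
    rw [hy, intertwining_apply_smul p, ← GaloisRep.restrictField_apply (L := E) ρZ,
      homGaloisModule_apply_smul (GaloisRep.restrictField E ρZ) ρU' σ']
  -- (2) expand `φτ' (p y₁)` and push `σ'` through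
  have h2 : ρU' σ' ((show Z →ₗ[ℤ] U' from φ τ') (p y₁)) =
      π (uJ ((show Y →ₗ[ℤ] U from homGaloisModule ρY ρU (absGaloisRestrict K E σ') (ξt (absGaloisRestrict K E τ'))) y)) -
        ((show Y →ₗ[ℤ] U' from homGaloisModule (GaloisRep.restrictField E ρY) ρU' (σ' * τ') ηt) y -
          (show Y →ₗ[ℤ] U' from homGaloisModule (GaloisRep.restrictField E ρY) ρU' σ' ηt) y) := by
    rw [hφ, map_sub, map_sub, ← hπ, ← intertwining_apply_smul uJ, ← homGaloisModule_apply_smul ρY ρU, ← hy,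
      ← homGaloisModule_restrictField_apply_smul (ρY := ρY) σ' (homGaloisModule (GaloisRep.restrictField E ρY) ρU' τ' ηt) y₁,
      ← Module.End.mul_apply, ← map_mul, ← homGaloisModule_restrictField_apply_smul (ρY := ρY) σ' ηt y₁, ← hy]
  -- (3) the two untwisted terms
  have h3 : (show Z →ₗ[ℤ] U' from φ (σ' * τ')) (p y) =
      π (uJ ((show Y →ₗ[ℤ] U from ξt (absGaloisRestrict K E σ' * absGaloisRestrict K E τ')) y)) -
        ((show Y →ₗ[ℤ] U' from homGaloisModule (GaloisRep.restrictField E ρY) ρU' (σ' * τ') ηt) y -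
          (show Y →ₗ[ℤ] U' from ηt) y) := by
    rw [hφ, map_mul (absGaloisRestrict K E) σ' τ']
  have h4 := hφ σ' y
  rw [h1, h2, h3, h4, hF, map_add, map_sub, map_add, map_sub]
  abel

/-! ## §3 The local `2`-cocycle of the bridge's admissible choice IS `π Z` up to a coboundary -/

omit [Module.Finite ℤ X] [Module.Finite ℤ Z] in
/-- **ON THE NOSE: `φ ∪ γ|_E − (π ∘ uJ) H|_E = π Z|_E − d(η̃ ∘ γ̃|_E)`** pointwise:
`φ(σ')(σ' γ(θτ')) − π (uJ (H(θσ',θτ'))) = π (Z(θσ',θτ')) − (σ' η̃(γ̃(θτ')) − η̃(γ̃(θ(σ'τ'))) + η̃(γ̃(θσ')))`.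
Hypotheses (all from S2a and the lifts): `p γ̃ = γ`, `i ∘ c = dγ̃`, `η̃ ∘ i = π ∘ h̃`, `B = uJ(ξ̃ ∪ γ̃) + h̃ ∘ c`, `Z = B − uJ ∘ H`, and
the defining identity of `φ`.  The left side is the value at `(σ', τ')` of the local `2`-cocycle `φ ∪ γ − h` of the admissible
choice `(H; φ)` (`ContPairing.cupSubCocycle` for the evaluation pairing `Hom(Z, U') × Z → U'`); the right side is the `π`-projection
of the idèle cocycle `Z` restricted to `Γ_E`, minus the coboundary of the `1`-cochain `σ' ↦ η̃(γ̃(θσ'))`.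
[cite: MilneADT2006, I Thm. 4.10 (a) (proof, p. 58), Lemma 4.13][cite: NeukirchSchmidtWingberg2008, Prop. 1.4.1, (1.5.2)] -/
theorem bridgeLocalCocycle_eq
    (ht : DiscreteRep.HomCarrier X J)
    (ξt : C(absoluteGaloisGroup K, DiscreteRep.HomCarrier Y U))
    (γ : contOneCocycles ρZ.toTopRep) (γt : C(absoluteGaloisGroup K, Y)) (hγt : ∀ σ, p (γt σ) = γ.1 σ)
    (c : C(absoluteGaloisGroup K × absoluteGaloisGroup K, X))
    (hc : ∀ σ τ : absoluteGaloisGroup K, i (c (σ, τ)) = ρY σ (γt τ) - γt (σ * τ) + γt σ)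
    (B : C(absoluteGaloisGroup K × absoluteGaloisGroup K, J))
    (hB : ∀ σ τ : absoluteGaloisGroup K,
      B (σ, τ) = uJ ((show Y →ₗ[ℤ] U from ξt σ) (ρY σ (γt τ))) + (show X →ₗ[ℤ] J from ht) (c (σ, τ)))
    (H : C(absoluteGaloisGroup K × absoluteGaloisGroup K, U))
    (Zc : C(absoluteGaloisGroup K × absoluteGaloisGroup K, J))
    (hZ : ∀ σ τ : absoluteGaloisGroup K, Zc (σ, τ) = B (σ, τ) - uJ (H (σ, τ)))
    (ηt : DiscreteRep.HomCarrier Y U') (hηt : ∀ x : X, (show Y →ₗ[ℤ] U' from ηt) (i x) = π ((show X →ₗ[ℤ] J from ht) x))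
    (φ : C(absoluteGaloisGroup E, DiscreteRep.HomCarrier Z U'))
    (hφ : ∀ (σ' : absoluteGaloisGroup E) (y : Y), (show Z →ₗ[ℤ] U' from φ σ') (p y) =
      π (uJ ((show Y →ₗ[ℤ] U from ξt (absGaloisRestrict K E σ')) y)) -
        ((show Y →ₗ[ℤ] U' from homGaloisModule (GaloisRep.restrictField E ρY) ρU' σ' ηt) y - (show Y →ₗ[ℤ] U' from ηt) y))
    (σ' τ' : absoluteGaloisGroup E) :
    (show Z →ₗ[ℤ] U' from φ σ') (ρZ (absGaloisRestrict K E σ') (γ.1 (absGaloisRestrict K E τ'))) -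
        π (uJ (H (absGaloisRestrict K E σ', absGaloisRestrict K E τ'))) =
      π (Zc (absGaloisRestrict K E σ', absGaloisRestrict K E τ')) -
        (ρU' σ' ((show Y →ₗ[ℤ] U' from ηt) (γt (absGaloisRestrict K E τ'))) -
          (show Y →ₗ[ℤ] U' from ηt) (γt (absGaloisRestrict K E (σ' * τ'))) +
          (show Y →ₗ[ℤ] U' from ηt) (γt (absGaloisRestrict K E σ'))) := by
  set σ := absGaloisRestrict K E σ' with hσ
  set τ := absGaloisRestrict K E τ' with hτ
  -- (1) `σ γ(τ) = p (σ γ̃(τ))`, so `φ(σ')` may be evaluated through `hφ`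
  have h1 : ρZ σ (γ.1 τ) = p (ρY σ (γt τ)) := by
    rw [intertwining_apply_smul p, hγt]
  -- (2) `σ γ̃(τ) = i c(σ,τ) + γ̃(στ) − γ̃(σ)`
  have h2 : ρY σ (γt τ) = i (c (σ, τ)) + γt (σ * τ) - γt σ := by
    rw [hc]; abel
  -- (3) `η̃(σ γ̃ τ) = π (h̃ c(σ,τ)) + η̃ γ̃(στ) − η̃ γ̃(σ)`
  have h3 : (show Y →ₗ[ℤ] U' from ηt) (ρY σ (γt τ)) =
      π ((show X →ₗ[ℤ] J from ht) (c (σ, τ))) + (show Y →ₗ[ℤ] U' from ηt) (γt (σ * τ)) -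
        (show Y →ₗ[ℤ] U' from ηt) (γt σ) := by
    rw [h2, map_sub, map_add, hηt]
  -- (4) the twisted `η̃`-term on `σ γ̃ τ`
  have h4 : (show Y →ₗ[ℤ] U' from homGaloisModule (GaloisRep.restrictField E ρY) ρU' σ' ηt) (ρY σ (γt τ)) =
      ρU' σ' ((show Y →ₗ[ℤ] U' from ηt) (γt τ)) := by
    rw [hσ]
    exact homGaloisModule_restrictField_apply_smul (ρY := ρY) σ' ηt (γt τ)
  rw [h1, hφ, h4, h3, hZ, hB, map_sub, map_add, hσ, hτ, map_mul (absGaloisRestrict K E) σ' τ']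
  abel

end Summit.BirchSwinnertonDyer.BirchSwinnertonDyer.Theorems.ShaTwoCochain

end
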